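import Mathlib
import Literature.Topology.PlaneTopology.WindingNumber
import Literature.Topology.PlaneTopology.AnnulusLogarithm
import HarnessLib

/-!
# Double points of perturbed cusps, I: the planar design lemma

This is the first of the files proving, in flat model form, D. McDuff's theorem that a critical
point of a `J`-holomorphic curve in an almost complex `4`-manifold contributes positively to the
local self-intersection number, so that every `C¹`-close `J`-holomorphic IMMERSION of a
neighbourhood of a cusp has double points (D. McDuff, *The local behaviour of holomorphic curves
in almost complex 4-manifolds*, J. Differential Geom. 34 (1991), Thm 1.4 with Cor. 4.4 and (5.6);
the statement `Literature.Geometry.Symplectic.jHolomorphic_immersed_of_limitEmbedded_punctured` is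
reduced to exactly this in `JHolomorphicLocalIntersectionsProofs.lean`,
`jHolomorphic_immersed_of_limitEmbedded_punctured_of_flat`). The proof organised in these files
replaces McDuff's bundle-theoretic self-intersection number (Def. 4.1) by a count of solutions of
`h z - h w = ε e(w)` on the bidisc for a push-off field `e`, evaluated with the tree's homological
degree theory (`Literature.AlgebraicTopology.SingularHomology.sum_detSign_eq_zero`, Milnor,
*Topology from the differentiable viewpoint*, §6).

The present file is planar and self-contained: it constructs the second component of the push-off
field in the critical chart. **Design lemma** (`exists_designField`): given a continuous zero-free
`q` on an annulus `ρ₁ ≤ ‖w‖ ≤ s` with winding number `N` along the inner circle, there is a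
continuous `e` on the disc `‖w‖ ≤ s`, equal to `q` near the outer part of the annulus and to `1`
near the origin, whose zeros are an explicit set of `|N|` NON-DEGENERATE zeros whose Jacobians all
have the sign of `N` — the elementary instance of "degree on the disc = winding number on the
boundary" that the degree count needs, with the zeros in general position by construction rather
than by Sard's theorem. Ingredients: the zeros of `wᴺ - c(‖w‖²)` (`w̄^{|N|} - c(‖w‖²)` for
`N < 0`) for a decreasing radial profile `c` lie on one circle and are non-degenerate
(`exists_design_of_twist`, with the sign read off from `|u|² det L = Im (conj (L u) · L (u i))`,
`normSq_mul_det`); continuation to `q` along a continuous logarithm of `q / w^{±N}` on the annulus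
(`Literature.Topology.PlaneTopology.hasLogOn_annulus_of_wind_eq_zero`, Eilenberg 1936).

Everything is proved; there are no definitions and no named facts.

## References

* D. McDuff, *The local behaviour of holomorphic curves in almost complex 4-manifolds*,
  J. Differential Geom. 34 (1991) 143–164, Thm 1.4, Def. 4.1, Cor. 4.4, (5.6).
  [McDuff1991LocalBehaviour]
* J. Milnor, *Topology from the Differentiable Viewpoint* (1965), §6. [MilnorTDV1965]
* S. Eilenberg, Transformations continues en circonférence et la topologie du plan, Fund. Math.
  26 (1936) 61–112. [Eilenberg1936]
-/

noncomputable section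

open scoped Real ComplexConjugate Topology
open Complex Set Filter Metric Literature.Topology.PlaneTopology

namespace Literature.Geometry.Symplectic

namespace CuspDoublePoints

/-! ### The determinant of a real-linear self-map of `ℂ` -/

/-- The determinant of a real-linear map `L : ℂ → ℂ` in the basis `(1, i)`:
`det L = Re L(1) · Im L(i) - Re L(i) · Im L(1)`. [folklore] -/
theorem det_eq_re_mul_im_sub (L : ℂ →ₗ[ℝ] ℂ) :
    LinearMap.det L = (L 1).re * (L I).im - (L I).re * (L 1).im := by
  rw [← LinearMap.det_toMatrix Complex.basisOneI, Matrix.det_fin_two]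
  simp [LinearMap.toMatrix_apply, Complex.coe_basisOneI_repr, Complex.coe_basisOneI]

/-- **The determinant scales signed areas**: for a real-linear `L : ℂ → ℂ` and any `u`,
`|u|² · det L = Im (conj (L u) · L (u i))`. [folklore] -/
theorem normSq_mul_det (L : ℂ →ₗ[ℝ] ℂ) (u : ℂ) :
    normSq u * LinearMap.det L = (conj (L u) * L (u * I)).im := by
  set M : ℂ →ₗ[ℝ] ℂ := (LinearMap.mul ℂ ℂ u).restrictScalars ℝ with hM
  have hMapp : ∀ z, M z = u * z := fun z => rfl
  have hdetM : LinearMap.det M = normSq u := by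
    rw [det_eq_re_mul_im_sub, hMapp, hMapp, mul_one, normSq_apply]
    simp only [mul_re, mul_im, I_re, I_im, mul_zero, mul_one, zero_sub]
    ring
  have hcomp : LinearMap.det (L ∘ₗ M) = (conj (L u) * L (u * I)).im := by
    rw [det_eq_re_mul_im_sub]
    simp only [LinearMap.coe_comp, Function.comp_apply, hMapp, mul_one]
    simp only [mul_im, conj_re, conj_im]
    ring
  rw [← hdetM, mul_comm, ← LinearMap.det_comp, hcomp]

/-- Sign version: if `Im (conj (L u) · L (u i)) > 0` for some `u` then `det L > 0`, and
similarly for `< 0`. [folklore] -/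
theorem det_pos_of_im_pos (L : ℂ →ₗ[ℝ] ℂ) {u : ℂ} (hu : u ≠ 0)
    (h : 0 < (conj (L u) * L (u * I)).im) : 0 < LinearMap.det L := by
  have := normSq_mul_det L u
  have hn : 0 < normSq u := normSq_pos.2 hu
  nlinarith

/-- Sign version, negative case. [folklore] -/
theorem det_neg_of_im_neg (L : ℂ →ₗ[ℝ] ℂ) {u : ℂ} (hu : u ≠ 0)
    (h : (conj (L u) * L (u * I)).im < 0) : LinearMap.det L < 0 := by
  have := normSq_mul_det L u
  have hn : 0 < normSq u := normSq_pos.2 hu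
  nlinarith

/-! ### The two twists `w ↦ wⁿ` and `w ↦ w̄ⁿ` -/

/-- `wⁿ = rⁿ` (`r > 0`) iff `w = r ζ` for an `n`-th root of unity `ζ` (`n ≥ 1`). [folklore] -/
theorem pow_eq_pow_iff_exists_root {n : ℕ} (hn : 0 < n) {r : ℝ} (hr : 0 < r) (w : ℂ) :
    w ^ n = (r : ℂ) ^ n ↔ ∃ ζ ∈ Polynomial.nthRootsFinset n (1 : ℂ), w = r * ζ := by
  have hr0 : (r : ℂ) ≠ 0 := ofReal_ne_zero.2 hr.ne'
  constructor
  · intro h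
    refine ⟨w / r, (Polynomial.mem_nthRootsFinset hn (1 : ℂ)).2 ?_, by field_simp⟩
    rw [div_pow, h, div_self (pow_ne_zero _ hr0)]
  · rintro ⟨ζ, hζ, rfl⟩
    rw [mul_pow, (Polynomial.mem_nthRootsFinset hn (1 : ℂ)).1 hζ, mul_one]

/-- `w̄ⁿ = rⁿ` (`r > 0`) iff `w = r ζ` for an `n`-th root of unity `ζ` (`n ≥ 1`). [folklore] -/
theorem conj_pow_eq_pow_iff_exists_root {n : ℕ} (hn : 0 < n) {r : ℝ} (hr : 0 < r) (w : ℂ) :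
    conj w ^ n = (r : ℂ) ^ n ↔ ∃ ζ ∈ Polynomial.nthRootsFinset n (1 : ℂ), w = r * ζ := by
  rw [← pow_eq_pow_iff_exists_root hn hr]
  constructor
  · intro h
    have := congrArg conj h
    rwa [map_pow, conj_conj, map_pow, conj_ofReal] at this
  · intro h
    rw [← map_pow, h, map_pow, conj_ofReal]

/-- The circle of radius `r > 0` raised to the power `n` winds `n` times. [folklore] -/
theorem wind_circleLoop_pow {r : ℝ} (hr : 0 < r) (n : ℕ) :
    wind (fun t => circleLoop 0 r t ^ n) = n := by
  have hl : IsNonvanishingLoop (circleLoop 0 r) :=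
    isNonvanishingLoop_circleLoop (by rw [norm_zero, abs_of_pos hr]; exact hr.ne)
  have := wind_zpow hl n
  simp only [zpow_natCast] at this
  rw [this, wind_circleLoop_zero hr, mul_one]

/-- The conjugate circle of radius `r > 0` raised to the power `n` winds `-n` times. [folklore] -/
theorem wind_conj_circleLoop_pow {r : ℝ} (hr : 0 < r) (n : ℕ) :
    wind (fun t => conj (circleLoop 0 r t) ^ n) = -n := by
  have hl : IsNonvanishingLoop (circleLoop 0 r) :=
    isNonvanishingLoop_circleLoop (by rw [norm_zero, abs_of_pos hr]; exact hr.ne)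
  have hlc : IsNonvanishingLoop fun t => conj (circleLoop 0 r t) :=
    ⟨continuous_conj.comp_continuousOn hl.continuousOn,
      fun t ht => (map_ne_zero_iff _ (RingHom.injective _)).2 (hl.ne_zero t ht),
      by rw [hl.eq_endpoints]⟩
  have := wind_zpow hlc n
  simp only [zpow_natCast] at this
  rw [this, wind_conj hl, wind_circleLoop_zero hr, mul_neg, mul_one]

/-! ### The clamped linear profile -/

/-- The clamp vanishes left of `0`. [folklore] -/
theorem clamp_of_le_zero {t : ℝ} (h : t ≤ 0) : max 0 (min 1 t) = 0 :=
  max_eq_left ((min_le_right _ _).trans h)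

/-- The clamp is `1` right of `1`. [folklore] -/
theorem clamp_of_one_le {t : ℝ} (h : 1 ≤ t) : max 0 (min 1 t) = 1 := by
  rw [min_eq_left h, max_eq_right zero_le_one]

/-- The clamp is the identity on `[0, 1]`. [folklore] -/
theorem clamp_of_mem {t : ℝ} (h : t ∈ Icc (0 : ℝ) 1) : max 0 (min 1 t) = t := by
  rw [min_eq_right h.2, max_eq_right h.1]

/-- The clamp is continuous. [folklore] -/
theorem continuous_clamp : Continuous fun t : ℝ => max 0 (min 1 t) :=
  continuous_const.max (continuous_const.min continuous_id)

/-- The clamp is monotone. [folklore] -/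
theorem clamp_mono : Monotone fun t : ℝ => max 0 (min 1 t) :=
  fun _ _ h => max_le_max le_rfl (min_le_min le_rfl h)

/-! ### The design lemma for a given twist -/

/-- **Design lemma, twisted form.** Let `q` be continuous and zero-free on the annulus
`ρ₁ ≤ ‖w‖ ≤ s` with winding number `N ≠ 0` on the inner circle, and let `τ` be a "twist of degree
`N`": continuous, `‖τ w‖ = ‖w‖ⁿ` (`n = |N|`), `τ w = rⁿ` exactly on `r · μₙ`, differentiable with
`Dτ(w) w = n τ(w)`, `Dτ(w)(iw) = σ i n τ(w)` (`σ N > 0`), winding `N` on circles. Then there is a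
continuous `e` on `‖w‖ ≤ s` equal to `q` for `ρ₂ ≤ ‖w‖ ≤ s`, equal to `1` near `0`, whose zeros in
`‖w‖ ≤ s` are exactly `n` points `r⋆ ζ` (`ζⁿ = 1`) inside `a < ‖w‖ < ρ₁`, each a non-degenerate zero
with Jacobian of the sign of `N`. [folklore] -/
theorem exists_design_of_twist {s ρ₁ ρ₂ : ℝ} (hρ₁ : 0 < ρ₁) (h12 : ρ₁ < ρ₂) (h2s : ρ₂ ≤ s)
    {q : ℂ → ℂ} (hq : ContinuousOn q {w | ρ₁ ≤ ‖w‖ ∧ ‖w‖ ≤ s})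
    (hq0 : ∀ w, ρ₁ ≤ ‖w‖ → ‖w‖ ≤ s → q w ≠ 0) {N : ℤ} (hN0 : N ≠ 0)
    (hN : wind (fun t => q (circleLoop 0 ρ₁ t)) = N)
    {τ : ℂ → ℂ} {τ' : ℂ → ℂ →L[ℝ] ℂ} {σ : ℝ} (hτc : Continuous τ)
    (hτn : ∀ w, ‖τ w‖ = ‖w‖ ^ N.natAbs)
    (hτroot : ∀ r : ℝ, 0 < r → ∀ w, τ w = (r : ℂ) ^ N.natAbs ↔
      ∃ ζ ∈ Polynomial.nthRootsFinset N.natAbs (1 : ℂ), w = r * ζ)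
    (hτd : ∀ w, HasFDerivAt τ (τ' w) w)
    (hτ'1 : ∀ w, τ' w w = N.natAbs * τ w)
    (hτ'2 : ∀ w, τ' w (w * I) = σ * I * N.natAbs * τ w) (hσN : 0 < σ * N)
    (hτw : ∀ r : ℝ, 0 < r → wind (fun t => τ (circleLoop 0 r t)) = N) :
    ∃ (e : ℂ → ℂ) (Z : Finset ℂ) (D : ℂ → ℂ →L[ℝ] ℂ) (a : ℝ), 0 < a ∧ a < ρ₁ ∧
      ContinuousOn e (closedBall 0 s) ∧
      (∀ w, ρ₂ ≤ ‖w‖ → ‖w‖ ≤ s → e w = q w) ∧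
      (∀ w, ‖w‖ ≤ a → e w = 1) ∧
      (∀ w ∈ Z, a < ‖w‖ ∧ ‖w‖ < ρ₁) ∧
      (∀ w, ‖w‖ ≤ s → (e w = 0 ↔ w ∈ Z)) ∧
      Z.card = N.natAbs ∧
      (∀ w ∈ Z, HasFDerivAt e (D w) w) ∧
      (∀ w ∈ Z, 0 < (N : ℝ) * LinearMap.det (D w : ℂ →ₗ[ℝ] ℂ)) := by
  classical
  -- ### constants
  set n : ℕ := N.natAbs with hn_def
  have hnpos : 0 < n := Int.natAbs_pos.2 hN0
  have hn0 : n ≠ 0 := hnpos.ne'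
  set a : ℝ := ρ₁ / 4 with ha_def
  set b : ℝ := ρ₁ / 2 with hb_def
  set cc : ℝ := 3 * ρ₁ / 4 with hcc_def
  have ha : 0 < a := by positivity
  have hab : a < b := by rw [ha_def, hb_def]; linarith
  have hb : 0 < b := by positivity
  have hbc : b < cc := by rw [hb_def, hcc_def]; linarith
  have hcρ : cc < ρ₁ := by rw [hcc_def]; linarith
  have hcc : 0 < cc := by positivity
  have hρ₂ : 0 < ρ₂ := hρ₁.trans h12
  set c₀ : ℝ := b ^ n + 1 with hc₀_def
  have hc₀ : 0 < c₀ := by positivity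
  have hbc₀ : b ^ n < c₀ := by rw [hc₀_def]; linarith
  have hc₀C : (c₀ : ℂ) ≠ 0 := ofReal_ne_zero.2 hc₀.ne'
  have hb2a2 : 0 < b ^ 2 - a ^ 2 := by nlinarith
  have hc2b2 : 0 < cc ^ 2 - b ^ 2 := by nlinarith
  have hρ21 : 0 < ρ₂ ^ 2 - ρ₁ ^ 2 := by nlinarith
  -- ### profiles of `ρ = ‖w‖²`
  set Λ : ℝ → ℝ := fun ρ => max 0 (min 1 ((ρ - a ^ 2) / (b ^ 2 - a ^ 2))) with hΛ_def
  set κ : ℝ → ℝ := fun ρ => max 0 (min 1 ((cc ^ 2 - ρ) / (cc ^ 2 - b ^ 2))) with hκ_def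
  set Λ₂ : ℝ → ℝ := fun ρ => max 0 (min 1 ((ρ - ρ₁ ^ 2) / (ρ₂ ^ 2 - ρ₁ ^ 2))) with hΛ₂_def
  have hΛc : Continuous Λ := continuous_clamp.comp ((continuous_id.sub continuous_const).div_const _)
  have hκc : Continuous κ := continuous_clamp.comp ((continuous_const.sub continuous_id).div_const _)
  have hΛ₂c : Continuous Λ₂ :=
    continuous_clamp.comp ((continuous_id.sub continuous_const).div_const _)
  have hΛ_one : ∀ ρ, b ^ 2 ≤ ρ → Λ ρ = 1 := fun ρ hρ =>
    clamp_of_one_le ((one_le_div hb2a2).2 (by linarith))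
  have hΛ_zero : ∀ ρ, ρ ≤ a ^ 2 → Λ ρ = 0 := fun ρ hρ =>
    clamp_of_le_zero (div_nonpos_of_nonpos_of_nonneg (by linarith) hb2a2.le)
  have hκ_one : ∀ ρ, ρ ≤ b ^ 2 → κ ρ = 1 := fun ρ hρ =>
    clamp_of_one_le ((one_le_div hc2b2).2 (by linarith))
  have hκ_zero : ∀ ρ, cc ^ 2 ≤ ρ → κ ρ = 0 := fun ρ hρ =>
    clamp_of_le_zero (div_nonpos_of_nonpos_of_nonneg (by linarith) hc2b2.le)
  have hκ_lin : ∀ ρ, b ^ 2 ≤ ρ → ρ ≤ cc ^ 2 → κ ρ = (cc ^ 2 - ρ) / (cc ^ 2 - b ^ 2) :=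
    fun ρ h1 h2 => clamp_of_mem ⟨div_nonneg (by linarith) hc2b2.le,
      (div_le_one hc2b2).2 (by linarith)⟩
  have hκ_nonneg : ∀ ρ, 0 ≤ κ ρ := fun ρ => le_max_left _ _
  have hΛ_nonneg : ∀ ρ, 0 ≤ Λ ρ := fun ρ => le_max_left _ _
  have hΛ_le_one : ∀ ρ, Λ ρ ≤ 1 := fun ρ => max_le zero_le_one (min_le_left _ _)
  have hΛ₂_zero : ∀ ρ, ρ ≤ ρ₁ ^ 2 → Λ₂ ρ = 0 := fun ρ hρ =>
    clamp_of_le_zero (div_nonpos_of_nonpos_of_nonneg (by linarith) hρ21.le)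
  have hΛ₂_one : ∀ ρ, ρ₂ ^ 2 ≤ ρ → Λ₂ ρ = 1 := fun ρ hρ =>
    clamp_of_one_le ((one_le_div hρ21).2 (by linarith))
  have hκ_anti : Antitone κ := fun ρ ρ' h =>
    clamp_mono (div_le_div_of_nonneg_right (by linarith) hc2b2.le)
  -- ### the path `γ` from `1` to `-c₀` in `ℂ ∖ 0`
  set γ : ℝ → ℂ := fun t => exp (t * (Real.log c₀ + π * I)) with hγ_def
  have hγc : Continuous γ := by
    rw [hγ_def]; fun_prop
  have hγ0 : γ 0 = 1 := by simp [hγ_def]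
  have hγ1 : γ 1 = -c₀ := by
    simp only [hγ_def, ofReal_one, one_mul, exp_add, exp_pi_mul_I, mul_neg, mul_one]
    rw [← ofReal_exp, Real.exp_log hc₀]
  have hγne : ∀ t, γ t ≠ 0 := fun t => exp_ne_zero _
  -- ### nonvanishing of `τ` off the origin
  have hτ0 : ∀ w, w ≠ 0 → τ w ≠ 0 := fun w hw h0 => by
    have := hτn w
    rw [h0, norm_zero] at this
    exact pow_ne_zero _ (norm_ne_zero_iff.2 hw) this.symm
  -- ### the logarithm of `q / τ` on the annulus `ρ₁ ≤ ‖w‖ ≤ s`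
  set A : Set ℂ := {w | ρ₁ ≤ ‖w‖ ∧ ‖w‖ ≤ s} with hA_def
  have hAne : ∀ w ∈ A, w ≠ 0 := fun w hw h0 => by
    simp only [hA_def, mem_setOf_eq, h0, norm_zero] at hw; linarith [hw.1]
  have hqτc : ContinuousOn (fun w => q w / τ w) A :=
    hq.div hτc.continuousOn fun w hw => hτ0 w (hAne w hw)
  have hqτ0 : ∀ w ∈ A, q w / τ w ≠ 0 := fun w hw =>
    div_ne_zero (hq0 w hw.1 hw.2) (hτ0 w (hAne w hw))
  have hloopq : IsNonvanishingLoop fun t => q (circleLoop 0 ρ₁ t) := by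
    refine ⟨hq.comp (continuous_circleLoop 0 ρ₁).continuousOn fun t _ => ?_,
      fun t _ => hq0 _ ?_ ?_, by simp only [circleLoop_zero_eq]⟩
    · have := norm_circleLoop_sub_center 0 ρ₁ t
      rw [sub_zero, abs_of_pos hρ₁] at this
      exact ⟨this.ge, this.le.trans (h12.le.trans h2s)⟩
    · have := norm_circleLoop_sub_center 0 ρ₁ t
      rw [sub_zero, abs_of_pos hρ₁] at this
      exact this.ge
    · have := norm_circleLoop_sub_center 0 ρ₁ t
      rw [sub_zero, abs_of_pos hρ₁] at this
      exact this.le.trans (h12.le.trans h2s)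
  have hloopτ : IsNonvanishingLoop fun t => τ (circleLoop 0 ρ₁ t) := by
    refine ⟨hτc.comp_continuousOn (continuous_circleLoop 0 ρ₁).continuousOn,
      fun t _ => hτ0 _ ?_, by simp only [circleLoop_zero_eq]⟩
    intro h0
    have := norm_circleLoop_sub_center 0 ρ₁ t
    rw [h0, zero_sub, norm_neg, norm_zero, abs_of_pos hρ₁] at this
    exact hρ₁.ne this
  have hwind0 : wind (fun t => q (circleLoop 0 ρ₁ t) / τ (circleLoop 0 ρ₁ t)) = 0 := by
    rw [wind_div hloopq hloopτ, hN, hτw ρ₁ hρ₁, sub_self]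
  obtain ⟨ℓ, hℓc, hℓe⟩ : HasLogOn (fun w => q w / τ w) A := by
    have hA' : A = {z : ℂ | ρ₁ ≤ ‖z - 0‖ ∧ ‖z - 0‖ ≤ s} := by simp only [sub_zero, hA_def]
    rw [hA']
    refine hasLogOn_annulus_of_wind_eq_zero hρ₁ (by rw [← hA']; exact hqτc)
      (fun z h1 h2 => hqτ0 z (by rw [hA']; exact ⟨h1, h2⟩)) hwind0
  -- ### the two formulas and the field
  set Ein : ℂ → ℂ := fun w =>
    γ (Λ (‖w‖ ^ 2)) * ((κ (‖w‖ ^ 2) : ℂ) - Λ (‖w‖ ^ 2) * τ w / c₀) with hEin_def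
  set Eout : ℂ → ℂ := fun w => τ w * exp (Λ₂ (‖w‖ ^ 2) * ℓ w) with hEout_def
  set e : ℂ → ℂ := fun w => if ‖w‖ ≤ ρ₁ then Ein w else Eout w with he_def
  have hEin_c : Continuous Ein := by
    have h2 : Continuous fun w : ℂ => ‖w‖ ^ 2 := continuous_norm.pow 2
    refine (hγc.comp (hΛc.comp h2)).mul ?_
    refine ((continuous_ofReal.comp (hκc.comp h2)).sub ?_)
    exact ((continuous_ofReal.comp (hΛc.comp h2)).mul hτc).div_const _
  have hEout_c : ContinuousOn Eout A := by
    refine hτc.continuousOn.mul (ContinuousOn.cexp ?_)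
    exact (continuous_ofReal.comp (hΛ₂c.comp (continuous_norm.pow 2))).continuousOn.mul hℓc
  -- values of `Ein` in the two regimes `‖w‖ ≤ b` and `b ≤ ‖w‖`
  have hEin_out : ∀ w, b ≤ ‖w‖ → Ein w = τ w - c₀ * κ (‖w‖ ^ 2) := by
    intro w hw
    have h1 : Λ (‖w‖ ^ 2) = 1 := hΛ_one _ (pow_le_pow_left₀ hb.le hw 2)
    simp only [hEin_def, h1, hγ1, ofReal_one, one_mul]
    field_simp
    ring
  have hEin_in : ∀ w, ‖w‖ ≤ b → Ein w ≠ 0 := by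
    intro w hw
    have h1 : κ (‖w‖ ^ 2) = 1 := hκ_one _ (pow_le_pow_left₀ (norm_nonneg _) hw 2)
    simp only [hEin_def, h1, ofReal_one]
    refine mul_ne_zero (hγne _) (sub_ne_zero.2 fun h => ?_)
    have h2 : ‖(Λ (‖w‖ ^ 2) : ℂ) * τ w / c₀‖ < 1 := by
      rw [norm_div, norm_mul, norm_real, Real.norm_of_nonneg (hΛ_nonneg _),
        norm_real, Real.norm_of_nonneg hc₀.le, hτn, div_lt_one hc₀]
      calc Λ (‖w‖ ^ 2) * ‖w‖ ^ n ≤ 1 * b ^ n := by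
            refine mul_le_mul (hΛ_le_one _) (pow_le_pow_left₀ (norm_nonneg _) hw n)
              (pow_nonneg (norm_nonneg _) _) zero_le_one
        _ < c₀ := by rw [one_mul]; exact hbc₀
    rw [← h] at h2
    simp at h2
  -- `Ein = τ` on the circle `‖w‖ = ρ₁`, and `Eout = τ` there
  have hEin_ρ₁ : ∀ w, ‖w‖ = ρ₁ → Ein w = τ w := by
    intro w hw
    rw [hEin_out w (by rw [hw]; linarith), hw, hκ_zero _ (pow_le_pow_left₀ hcc.le hcρ.le 2)]
    simp
  have hEout_ρ₁ : ∀ w, ‖w‖ = ρ₁ → Eout w = τ w := by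
    intro w hw
    simp only [hEout_def, hw, hΛ₂_zero _ le_rfl, ofReal_zero, zero_mul, exp_zero, mul_one]
  -- ### the zero radius `r⋆`
  set φ : ℝ → ℝ := fun r => r ^ n - c₀ * κ (r ^ 2) with hφ_def
  have hφc : Continuous φ := (continuous_pow n).sub (continuous_const.mul (hκc.comp (continuous_pow 2)))
  have hφb : φ b < 0 := by
    simp only [hφ_def, hκ_one _ le_rfl, mul_one]; linarith
  have hφcc : 0 < φ cc := by
    simp only [hφ_def, hκ_zero _ le_rfl, mul_zero, sub_zero]; positivity
  obtain ⟨rs, hrs, hφrs⟩ : ∃ r ∈ Ioo b cc, φ r = 0 := by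
    have := intermediate_value_Ioo hbc.le hφc.continuousOn
    exact this ⟨hφb, hφcc⟩
  have hrs0 : 0 < rs := hb.trans hrs.1
  have hrsρ₁ : rs < ρ₁ := hrs.2.trans hcρ
  have hφmono : StrictMonoOn φ (Ici 0) := by
    intro r hr r' _ hrr'
    have h1 : r ^ n < r' ^ n := pow_lt_pow_left₀ hrr' hr hn0
    have h2 : κ (r' ^ 2) ≤ κ (r ^ 2) := hκ_anti (pow_le_pow_left₀ hr hrr'.le 2)
    simp only [hφ_def]
    nlinarith
  have hφinj : ∀ r, 0 ≤ r → φ r = 0 → r = rs := fun r hr h =>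
    hφmono.injOn hr (hrs0.le : (rs : ℝ) ∈ Ici 0) (h.trans hφrs.symm)
  have hrsn : (rs : ℝ) ^ n = c₀ * κ (rs ^ 2) := by
    have := hφrs; simp only [hφ_def] at this; linarith
  -- ### the zero set
  set Z : Finset ℂ := (Polynomial.nthRootsFinset n (1 : ℂ)).image fun ζ => (rs : ℂ) * ζ with hZ_def
  have hZnorm : ∀ w ∈ Z, ‖w‖ = rs := by
    intro w hw
    obtain ⟨ζ, hζ, rfl⟩ := Finset.mem_image.1 hw
    rw [norm_mul, norm_real, Real.norm_of_nonneg hrs0.le,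
      Complex.norm_eq_one_of_pow_eq_one ((Polynomial.mem_nthRootsFinset hnpos (1 : ℂ)).1 hζ) hn0,
      mul_one]
  have hZτ : ∀ w ∈ Z, τ w = (rs : ℂ) ^ n := by
    intro w hw
    obtain ⟨ζ, hζ, rfl⟩ := Finset.mem_image.1 hw
    exact (hτroot rs hrs0 _).2 ⟨ζ, hζ, rfl⟩
  have hZne : ∀ w ∈ Z, w ≠ 0 := fun w hw h0 => by
    have := hZnorm w hw; rw [h0, norm_zero] at this; exact hrs0.ne this
  -- ### the derivative at the zeros
  set D : ℂ → ℂ →L[ℝ] ℂ := fun w =>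
    τ' w + ofRealCLM.comp ((c₀ / (cc ^ 2 - b ^ 2)) • ((2 : ℕ) • innerSL ℝ w)) with hD_def
  have hD : ∀ w ∈ Z, HasFDerivAt e (D w) w := by
    intro w hw
    have hwn := hZnorm w hw
    -- `e` agrees near `w` with `τ - c₀ κlin(‖·‖²)`
    have hU : ∀ᶠ y in 𝓝 w, e y = (τ y + ((c₀ / (cc ^ 2 - b ^ 2) * ‖y‖ ^ 2 : ℝ) : ℂ)) -
        ((c₀ * cc ^ 2 / (cc ^ 2 - b ^ 2) : ℝ) : ℂ) := by
      have hopen : IsOpen {y : ℂ | b < ‖y‖ ∧ ‖y‖ < cc} :=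
        (isOpen_lt continuous_const continuous_norm).inter (isOpen_lt continuous_norm continuous_const)
      have hwU : w ∈ {y : ℂ | b < ‖y‖ ∧ ‖y‖ < cc} := by rw [mem_setOf_eq, hwn]; exact hrs
      filter_upwards [hopen.mem_nhds hwU] with y hy
      have hy1 : ‖y‖ ≤ ρ₁ := hy.2.le.trans hcρ.le
      have h : e y = Ein y := by simp only [he_def, if_pos hy1]
      rw [h, hEin_out y hy.1.le, hκ_lin _ (pow_le_pow_left₀ hb.le hy.1.le 2)
        (pow_le_pow_left₀ (norm_nonneg _) hy.2.le 2)]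
      push_cast
      field_simp
      ring
    have h1 : HasFDerivAt (fun y : ℂ => ‖y‖ ^ 2) ((2 : ℕ) • innerSL ℝ w) w :=
      (hasStrictFDerivAt_norm_sq w).hasFDerivAt
    have h2 : HasFDerivAt (fun y : ℂ => c₀ / (cc ^ 2 - b ^ 2) * ‖y‖ ^ 2)
        ((c₀ / (cc ^ 2 - b ^ 2)) • ((2 : ℕ) • innerSL ℝ w)) w := h1.const_mul _
    have h3 : HasFDerivAt (fun y : ℂ => ((c₀ / (cc ^ 2 - b ^ 2) * ‖y‖ ^ 2 : ℝ) : ℂ))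
        (ofRealCLM.comp ((c₀ / (cc ^ 2 - b ^ 2)) • ((2 : ℕ) • innerSL ℝ w))) w :=
      ofRealCLM.hasFDerivAt.comp w h2
    have h4 := ((hτd w).add h3).sub_const ((c₀ * cc ^ 2 / (cc ^ 2 - b ^ 2) : ℝ) : ℂ)
    exact (h4.congr_of_eventuallyEq hU)
  -- values of `D w` on `w` and `w i`
  have hDw : ∀ w ∈ Z, D w w = ((n * rs ^ n + c₀ / (cc ^ 2 - b ^ 2) * (2 * rs ^ 2) : ℝ) : ℂ) := by
    intro w hw
    have hin : @inner ℝ ℂ _ w w = rs ^ 2 := by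
      rw [real_inner_self_eq_norm_sq, hZnorm w hw]
    simp only [hD_def, ContinuousLinearMap.coe_comp,
      Function.comp_apply, innerSL_apply_apply, hin, add_apply, smul_apply, hτ'1,
      hZτ w hw, ofRealCLM_apply, smul_eq_mul, nsmul_eq_mul]
    push_cast
    ring
  have hDwI : ∀ w ∈ Z, D w (w * I) = σ * I * n * (rs : ℂ) ^ n := by
    intro w hw
    have h0 : @inner ℝ ℂ _ w (w * I) = 0 := by
      rw [Complex.inner]
      have : w * I * conj w = (normSq w : ℂ) * I := by rw [mul_comm, ← mul_assoc, mul_comm (conj w), mul_conj]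
      rw [this]
      simp
    simp only [hD_def, ContinuousLinearMap.coe_comp,
      Function.comp_apply, innerSL_apply_apply, h0, add_apply, smul_apply,
      smul_zero, ofRealCLM_apply, ofReal_zero, add_zero, hτ'2, hZτ w hw]
  refine ⟨e, Z, D, a, ha, hab.trans (hbc.trans hcρ), ?_, ?_, ?_, ?_, ?_, ?_, hD, ?_⟩
  · -- continuity on the closed disc
    have hfr : ∀ w ∈ closedBall (0 : ℂ) s ∩ frontier {w : ℂ | ‖w‖ ≤ ρ₁}, Ein w = Eout w := by
      intro w hw
      have hset : {w : ℂ | ‖w‖ ≤ ρ₁} = closedBall 0 ρ₁ := by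
        ext; simp
      rw [hset, frontier_closedBall _ hρ₁.ne'] at hw
      have hn : ‖w‖ = ρ₁ := by simpa using hw.2
      rw [hEin_ρ₁ w hn, hEout_ρ₁ w hn]
    refine ContinuousOn.if hfr hEin_c.continuousOn (hEout_c.mono ?_)
    intro w hw
    have h1 : w ∈ closure {w : ℂ | ¬‖w‖ ≤ ρ₁} := hw.2
    have hcl : closure {w : ℂ | ¬‖w‖ ≤ ρ₁} ⊆ {w : ℂ | ρ₁ ≤ ‖w‖} := by
      refine closure_minimal (fun w hw => le_of_lt (not_le.1 hw)) (isClosed_le continuous_const continuous_norm)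
    exact ⟨hcl h1, by simpa using hw.1⟩
  · -- agreement with `q` on `ρ₂ ≤ ‖w‖ ≤ s`
    intro w h1 h2
    have hnot : ¬‖w‖ ≤ ρ₁ := not_le.2 (h12.trans_le h1)
    have hwA : w ∈ A := ⟨(h12.le.trans h1), h2⟩
    simp only [he_def, if_neg hnot, hEout_def, hΛ₂_one _ (pow_le_pow_left₀ hρ₂.le h1 2),
      ofReal_one, one_mul, hℓe w hwA]
    field_simp [hτ0 w (hAne w hwA)]
  · -- `e = 1` near the origin
    intro w hw
    have h1 : ‖w‖ ≤ ρ₁ := hw.trans (hab.trans (hbc.trans hcρ)).le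
    have h2 : Λ (‖w‖ ^ 2) = 0 := hΛ_zero _ (pow_le_pow_left₀ (norm_nonneg _) hw 2)
    have h3 : κ (‖w‖ ^ 2) = 1 :=
      hκ_one _ (pow_le_pow_left₀ (norm_nonneg _) (hw.trans hab.le) 2)
    simp only [he_def, if_pos h1, hEin_def, h2, hγ0, h3, ofReal_one, ofReal_zero, zero_mul,
      zero_div, sub_zero, mul_one]
  · -- location of the zeros
    intro w hw
    rw [hZnorm w hw]
    exact ⟨hab.trans hrs.1, hrsρ₁⟩
  · -- the zero set
    intro w hws
    by_cases hw1 : ‖w‖ ≤ ρ₁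
    · have hew : e w = Ein w := by simp only [he_def, if_pos hw1]
      rw [hew]
      by_cases hwb : ‖w‖ ≤ b
      · refine ⟨fun h => absurd h (hEin_in w hwb), fun h => ?_⟩
        have := hZnorm w h
        linarith [hrs.1]
      · push Not at hwb
        rw [hEin_out w hwb.le]
        constructor
        · intro h
          have hτw : τ w = c₀ * κ (‖w‖ ^ 2) := sub_eq_zero.1 h
          have hnorm : ‖w‖ ^ n = c₀ * κ (‖w‖ ^ 2) := by
            rw [← hτn, hτw]
            rw [norm_mul, norm_real, norm_real, Real.norm_of_nonneg hc₀.le,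
              Real.norm_of_nonneg (hκ_nonneg _)]
          have hr : ‖w‖ = rs := hφinj ‖w‖ (norm_nonneg _) (by simp only [hφ_def]; linarith)
          have hτw' : τ w = (rs : ℂ) ^ n := by
            rw [hτw, hr]; exact_mod_cast hrsn.symm
          obtain ⟨ζ, hζ, hwζ⟩ := (hτroot rs hrs0 w).1 hτw'
          exact Finset.mem_image.2 ⟨ζ, hζ, hwζ.symm⟩
        · intro h
          rw [hZτ w h, hZnorm w h]
          rw [sub_eq_zero]; exact_mod_cast hrsn
    · have hew : e w = Eout w := by simp only [he_def, if_neg hw1]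
      push Not at hw1
      have hwA : w ∈ A := ⟨hw1.le, hws⟩
      refine ⟨fun h => ?_, fun h => ?_⟩
      · rw [hew, hEout_def] at h
        exact absurd h (mul_ne_zero (hτ0 w (hAne w hwA)) (exp_ne_zero _))
      · have := hZnorm w h; linarith
  · -- cardinality
    rw [hZ_def, Finset.card_image_of_injective _ (mul_right_injective₀ (ofReal_ne_zero.2 hrs0.ne')),
      (Complex.isPrimitiveRoot_exp n hn0).card_nthRootsFinset]
  · -- sign of the Jacobian
    intro w hw
    have hw0 : w ≠ 0 := hZne w hw
    set Aℝ : ℝ := n * rs ^ n + c₀ / (cc ^ 2 - b ^ 2) * (2 * rs ^ 2) with hAℝ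
    have hApos : 0 < Aℝ := by positivity
    have him : (conj ((D w : ℂ →ₗ[ℝ] ℂ) w) * (D w : ℂ →ₗ[ℝ] ℂ) (w * I)).im =
        σ * (Aℝ * n * rs ^ n) := by
      simp only [ContinuousLinearMap.coe_coe, hDw w hw, hDwI w hw, conj_ofReal]
      simp only [mul_im, mul_re, ofReal_re, ofReal_im, I_re, I_im, natCast_re, natCast_im]
      simp only [← ofReal_pow, ofReal_re, ofReal_im]
      ring
    have hkey := normSq_mul_det (D w : ℂ →ₗ[ℝ] ℂ) w
    rw [him] at hkey
    have hnsq : 0 < normSq w := normSq_pos.2 hw0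
    have hpos : 0 < Aℝ * n * rs ^ n := by positivity
    -- `normSq w * det = σ * P` with `P > 0` and `σ N > 0`
    have : (N : ℝ) * (normSq w * LinearMap.det (D w : ℂ →ₗ[ℝ] ℂ)) = σ * N * (Aℝ * n * rs ^ n) := by
      rw [hkey]; ring
    have h2 : 0 < (N : ℝ) * (normSq w * LinearMap.det (D w : ℂ →ₗ[ℝ] ℂ)) := by
      rw [this]; positivity
    have h3 : (N : ℝ) * (normSq w * LinearMap.det (D w : ℂ →ₗ[ℝ] ℂ)) =
        normSq w * ((N : ℝ) * LinearMap.det (D w : ℂ →ₗ[ℝ] ℂ)) := by ring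
    rw [h3] at h2
    exact (pos_iff_pos_of_mul_pos h2).1 hnsq

/-- **Design lemma.** Let `q` be continuous and zero-free on the annulus `ρ₁ ≤ ‖w‖ ≤ s`
(`0 < ρ₁ < ρ₂ ≤ s`) with winding number `N` along the inner circle. Then there is a continuous
`e : ℂ → ℂ` on the disc `‖w‖ ≤ s` with `e = q` for `ρ₂ ≤ ‖w‖ ≤ s` and `e = 1` for `‖w‖ ≤ a`
(some `0 < a < ρ₁`), whose zeros in the disc form an explicit finite set `Z` of `|N|` points with
`a < ‖w‖ < ρ₁`, each a non-degenerate zero (`e` is differentiable there) whose Jacobian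
determinant has the sign of `N`. (For `N > 0` the zeros are those of `wᴺ - c(‖w‖²)`, for `N < 0`
of `w̄^|N| - c(‖w‖²)`, `c` a decreasing radial profile; `e` is continued to `q` along a continuous
logarithm of `q / w^{±N}` on the annulus, which exists because that quotient does not wind.)
[folklore] -/
theorem exists_designField {s ρ₁ ρ₂ : ℝ} (hρ₁ : 0 < ρ₁) (h12 : ρ₁ < ρ₂) (h2s : ρ₂ ≤ s)
    {q : ℂ → ℂ} (hq : ContinuousOn q {w | ρ₁ ≤ ‖w‖ ∧ ‖w‖ ≤ s})
    (hq0 : ∀ w, ρ₁ ≤ ‖w‖ → ‖w‖ ≤ s → q w ≠ 0) {N : ℤ}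
    (hN : wind (fun t => q (circleLoop 0 ρ₁ t)) = N) :
    ∃ (e : ℂ → ℂ) (Z : Finset ℂ) (D : ℂ → ℂ →L[ℝ] ℂ) (a : ℝ), 0 < a ∧ a < ρ₁ ∧
      ContinuousOn e (closedBall 0 s) ∧
      (∀ w, ρ₂ ≤ ‖w‖ → ‖w‖ ≤ s → e w = q w) ∧
      (∀ w, ‖w‖ ≤ a → e w = 1) ∧
      (∀ w ∈ Z, a < ‖w‖ ∧ ‖w‖ < ρ₁) ∧
      (∀ w, ‖w‖ ≤ s → (e w = 0 ↔ w ∈ Z)) ∧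
      Z.card = N.natAbs ∧
      (∀ w ∈ Z, HasFDerivAt e (D w) w) ∧
      (∀ w ∈ Z, 0 < (N : ℝ) * LinearMap.det (D w : ℂ →ₗ[ℝ] ℂ)) := by
  classical
  rcases lt_trichotomy N 0 with hNneg | hN0 | hNpos
  · -- `N < 0`: the twist `w ↦ w̄ⁿ`
    set n := N.natAbs with hn_def
    have hnN : (n : ℤ) = -N := by rw [hn_def]; omega
    have hn0 : n ≠ 0 := by omega
    refine exists_design_of_twist hρ₁ h12 h2s hq hq0 hNneg.ne hN (τ := fun w => conj w ^ n)
      (τ' := fun w => (conjCLE : ℂ ≃L[ℝ] ℂ).toContinuousLinearMap.comp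
        ((ContinuousLinearMap.smulRight (1 : ℂ →L[ℂ] ℂ) ((n : ℂ) * w ^ (n - 1))).restrictScalars ℝ))
      (σ := -1) (continuous_conj.pow n) (fun w => by simp [hn_def]) ?_ ?_ ?_ ?_ ?_ ?_
    · intro r hr w
      exact conj_pow_eq_pow_iff_exists_root (Nat.pos_of_ne_zero hn0) hr w
    · intro w
      have h1 : HasFDerivAt (fun w : ℂ => w ^ n)
          ((ContinuousLinearMap.smulRight (1 : ℂ →L[ℂ] ℂ) ((n : ℂ) * w ^ (n - 1))).restrictScalars ℝ)
          w := (hasDerivAt_pow n w).hasFDerivAt.restrictScalars ℝ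
      have h2 := (conjCLE : ℂ ≃L[ℝ] ℂ).hasFDerivAt.comp w h1
      refine h2.congr_of_eventuallyEq (Eventually.of_forall fun y => ?_)
      simp [map_pow]
    · intro w
      simp only [ContinuousLinearMap.coe_comp, ContinuousLinearEquiv.coe_coe,
        Function.comp_apply, ContinuousLinearMap.coe_restrictScalars',
        ContinuousLinearMap.smulRight_apply, one_apply_eq_self, conjCLE_apply,
        smul_eq_mul, map_mul, map_natCast, map_pow]
      rw [mul_comm, mul_assoc, ← pow_succ, Nat.sub_add_cancel (Nat.pos_of_ne_zero hn0)]
    · intro w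
      simp only [ContinuousLinearMap.coe_comp, ContinuousLinearEquiv.coe_coe,
        Function.comp_apply, ContinuousLinearMap.coe_restrictScalars',
        ContinuousLinearMap.smulRight_apply, one_apply_eq_self, conjCLE_apply,
        smul_eq_mul]
      rw [show w * I * ((n : ℂ) * w ^ (n - 1)) = I * n * (w ^ (n - 1) * w) by ring, ← pow_succ,
        Nat.sub_add_cancel (Nat.pos_of_ne_zero hn0)]
      simp only [map_mul, map_natCast, map_pow, conj_I]
      push_cast
      ring
    · have : (N : ℝ) < 0 := by exact_mod_cast hNneg
      nlinarith
    · intro r hr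
      rw [wind_conj_circleLoop_pow hr n, hnN]
      ring
  · -- `N = 0`: no zeros are needed
    subst hN0
    set A : Set ℂ := {w | ρ₁ ≤ ‖w‖ ∧ ‖w‖ ≤ s} with hA_def
    have hρ₂ : 0 < ρ₂ := hρ₁.trans h12
    have hρ21 : 0 < ρ₂ ^ 2 - ρ₁ ^ 2 := by nlinarith
    obtain ⟨ℓ, hℓc, hℓe⟩ : HasLogOn q A := by
      have hA' : A = {z : ℂ | ρ₁ ≤ ‖z - 0‖ ∧ ‖z - 0‖ ≤ s} := by simp only [sub_zero, hA_def]
      rw [hA']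
      exact hasLogOn_annulus_of_wind_eq_zero hρ₁ (by rw [← hA']; exact hq)
        (fun z h1 h2 => hq0 z (by simpa using h1) (by simpa using h2)) hN
    set Λ₂ : ℝ → ℝ := fun ρ => max 0 (min 1 ((ρ - ρ₁ ^ 2) / (ρ₂ ^ 2 - ρ₁ ^ 2))) with hΛ₂_def
    have hΛ₂c : Continuous Λ₂ :=
      continuous_clamp.comp ((continuous_id.sub continuous_const).div_const _)
    have hΛ₂_zero : ∀ ρ, ρ ≤ ρ₁ ^ 2 → Λ₂ ρ = 0 := fun ρ hρ =>
      clamp_of_le_zero (div_nonpos_of_nonpos_of_nonneg (by linarith) hρ21.le)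
    have hΛ₂_one : ∀ ρ, ρ₂ ^ 2 ≤ ρ → Λ₂ ρ = 1 := fun ρ hρ =>
      clamp_of_one_le ((one_le_div hρ21).2 (by linarith))
    set e : ℂ → ℂ := fun w => if ‖w‖ ≤ ρ₁ then 1 else exp (Λ₂ (‖w‖ ^ 2) * ℓ w) with he_def
    refine ⟨e, ∅, fun _ => 0, ρ₁ / 2, by positivity, by linarith, ?_, ?_, ?_, by simp, ?_,
      by simp, by simp, by simp⟩
    · have hfr : ∀ w ∈ closedBall (0 : ℂ) s ∩ frontier {w : ℂ | ‖w‖ ≤ ρ₁},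
          (1 : ℂ) = exp (Λ₂ (‖w‖ ^ 2) * ℓ w) := by
        intro w hw
        have hset : {w : ℂ | ‖w‖ ≤ ρ₁} = closedBall 0 ρ₁ := by ext; simp
        rw [hset, frontier_closedBall _ hρ₁.ne'] at hw
        have hn : ‖w‖ = ρ₁ := by simpa using hw.2
        rw [hn, hΛ₂_zero _ le_rfl]; simp
      refine ContinuousOn.if hfr continuousOn_const (ContinuousOn.cexp ?_)
      refine ((continuous_ofReal.comp (hΛ₂c.comp (continuous_norm.pow 2))).continuousOn.mul
        (hℓc.mono ?_))
      intro w hw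
      have hcl : closure {w : ℂ | ¬‖w‖ ≤ ρ₁} ⊆ {w : ℂ | ρ₁ ≤ ‖w‖} :=
        closure_minimal (fun w hw => le_of_lt (not_le.1 hw))
          (isClosed_le continuous_const continuous_norm)
      exact ⟨hcl hw.2, by simpa using hw.1⟩
    · intro w h1 h2
      have hnot : ¬‖w‖ ≤ ρ₁ := not_le.2 (h12.trans_le h1)
      simp only [he_def, if_neg hnot, hΛ₂_one _ (pow_le_pow_left₀ hρ₂.le h1 2), ofReal_one,
        one_mul, hℓe w ⟨h12.le.trans h1, h2⟩]
    · intro w hw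
      have : ‖w‖ ≤ ρ₁ := by linarith
      simp only [he_def, if_pos this]
    · intro w _
      simp only [Finset.notMem_empty, iff_false]
      by_cases h : ‖w‖ ≤ ρ₁
      · simp only [he_def, if_pos h]; exact one_ne_zero
      · simp only [he_def, if_neg h]; exact exp_ne_zero _
  · -- `N > 0`: the twist `w ↦ wⁿ`
    set n := N.natAbs with hn_def
    have hnN : (n : ℤ) = N := by rw [hn_def]; omega
    have hn0 : n ≠ 0 := by omega
    refine exists_design_of_twist hρ₁ h12 h2s hq hq0 hNpos.ne' hN (τ := fun w => w ^ n)
      (τ' := fun w =>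
        (ContinuousLinearMap.smulRight (1 : ℂ →L[ℂ] ℂ) ((n : ℂ) * w ^ (n - 1))).restrictScalars ℝ)
      (σ := 1) (continuous_pow n) (fun w => by simp [hn_def]) ?_ ?_ ?_ ?_ ?_ ?_
    · intro r hr w
      exact pow_eq_pow_iff_exists_root (Nat.pos_of_ne_zero hn0) hr w
    · intro w
      exact (hasDerivAt_pow n w).hasFDerivAt.restrictScalars ℝ
    · intro w
      simp only [ContinuousLinearMap.coe_restrictScalars', ContinuousLinearMap.smulRight_apply,
        one_apply_eq_self, smul_eq_mul]
      rw [mul_comm, mul_assoc, ← pow_succ, Nat.sub_add_cancel (Nat.pos_of_ne_zero hn0)]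
    · intro w
      simp only [ContinuousLinearMap.coe_restrictScalars', ContinuousLinearMap.smulRight_apply,
        one_apply_eq_self, smul_eq_mul]
      rw [show w * I * ((n : ℂ) * w ^ (n - 1)) = I * n * (w ^ (n - 1) * w) by ring, ← pow_succ,
        Nat.sub_add_cancel (Nat.pos_of_ne_zero hn0)]
      push_cast
      ring
    · have : (0 : ℝ) < N := by exact_mod_cast hNpos
      nlinarith
    · intro r hr
      rw [wind_circleLoop_pow hr n, hnN]

end CuspDoublePoints

end Literature.Geometry.Symplectic
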